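import Literature.AlgebraicGeometry.HodgeTheory.CalabiYauHypersurfaceTopFormCharacter
import Literature.AlgebraicGeometry.HodgeTheory.DworkSexticTransportData
import Literature.AlgebraicGeometry.HodgeTheory.FermatFourfoldSemiDecomposableEigenlines
import Literature.AlgebraicGeometry.HodgeTheory.AlgebraicClassesHodgeTypeHolds
import HarnessLib

/-!
# The `Γ_W`-character of `H^{4,0}(X_ψ)` on the Dwork sextic pencil is trivial; Katz's flat pieces are pure modulo the Fermat point

Family `hodge`, layer `Literature/AlgebraicGeometry/HodgeTheory`. PROOF FILE (theorems only; no
definition, no named fact — D-0026), namespace `Literature.AlgebraicGeometry.HodgeTheory.DworkSextic`.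
For `ψ⁶ ≠ 1` let `X_ψ = V₊(Σ Xᵢ⁶ − 6ψ ∏ Xᵢ) ⊂ ℙ⁵_ℂ` be the (smooth) fibre of the Dwork sextic pencil
and `Γ_W = {a ∈ μ₆⁶ | ∏ aᵢ = 1}` its group of diagonal symmetries (`DworkSextic.gammaW`).

§1 (Katz 2009, §3 / Lemma 3.1, the `(4,0)`-part): `H⁰(X_ψ, Ω⁴) = ℂ · Res(Ω/F_ψ)` is fixed by `Γ_W`
(the holomorphic volume form transforms by `det = ∏ aᵢ = 1`), i.e. **the `(4,0)`-part of every
eigenspace `V_θ ⊆ H⁴(X_ψ(ℂ); ℂ)` of a non-trivial character `θ` of `Γ_W` is zero** — the instance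
`n = 4`, `F = F_ψ`, `G = Γ_W` of `hypersurface_eigenspace_hodgePQ_top_zero_eq_zero_of_ne_prod`
(`CalabiYauHypersurfaceTopFormCharacter`):
* `eq_zero_of_mem_eigenspace_of_hodgePQ_four_zero`, and `topCharacter_trivial` — the same packaged
  verbatim as the hypothesis `hZ` of the route files of `hodge-nonav`
  (`Summits/…/DworkReflectionQuotientsK2OfTopCharacter`), which it discharges.

§2 Consequently the tree's transport theorems (`DworkSexticTransportData`,
`DworkSexticFlatPiecesPurityOfTransport`: the `Γ_W`-equivariant real multiplicative transport along the
Dwork line and the Hodge–Riemann sign argument) make the purity `(2,2)` of a `Γ_W`-piece of `X_ψ` a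
statement about the FERMAT sextic fourfold alone:
* `pullback_mem_hodgePQ_two_two_of_fermat` — if the eigenspaces of `χ` and `χ⁻¹` (`χ ≠ 1`) in
  `H⁴(X⁴₆(ℂ); ℂ)` are of type `(2,2)`, so is `V_χ(X_ψ)`;
* `typeOne_pullback_mem_hodgePQ_two_two_of_fermat`, `isOfHodgeType_two_two_typeOne_of_fermat` — Katz's
  remaining flat type `(1,2,2,3,5,5) ∘ σ` / `(1,1,3,4,4,5) ∘ σ` (`j = 1`; the types `j = 0, 2, 3` are
  `flatTypes_pullback_mem_hodgePQ_two_two_of_topCharacter`, now unconditional) is pure at `ψ` as soon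
  as the `Γ_W`-pieces of `χ_{e₁∘σ}`, `χ_{(6−e₁)∘σ}` of `X⁴₆` are.

§3 At the Fermat point the `Γ_W`-piece of `χ_e` is the sum of the torus lines `V(e + r·𝟙)`,
`e + r·𝟙` totally nonzero (`fermat_gammaW_eigenspace_le`); a torus line spanned by algebraic cycles
is of type `(2,2)` (`isOfHodgeType_of_mem_algebraicClasses_of_isSmoothProjective`, Voisin I
Prop. 11.20). For `e₁ = (1,2,2,3,5,5)` the totally nonzero translates are `(1,2,2,3,5,5)` and
`(3,4,4,5,1,1)`, both SEMI-DECOMPOSABLE (`{1,2,3} ⊔ {2,5,5}`, `{3,4,5} ⊔ {4,1,1}`; likewise for the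
conjugate type), hence claimed by Shioda's theorem on semi-decomposable Hodge characters (the tree's
named fact `Shioda1979_claim_semiDecomposable`, Shioda 1979 PJA §4 / Ran 1980 §4):
* `fermat_gammaW_eigenspace_pullback_mem_hodgePQ_two_two_of_claim` — a `Γ_W`-piece of `X⁴₆` all of
  whose totally nonzero translates are claimed is of type `(2,2)`;
* `claim_translate_flatTypes_one_of_claims`, `fermat_typeOne_pullback_mem_hodgePQ_two_two_of_claims`,
  `isOfHodgeType_two_two_typeOne_of_claims` — **if the four torus lines `V(1,2,2,3,5,5)`, `V(3,4,4,5,1,1)`,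
  `V(5,4,4,3,1,1)`, `V(3,2,2,1,5,5)` of `X⁴₆` are spanned by algebraic `2`-cycles, the type `j = 1`
  pieces of `X_ψ` are pure `(2,2)`** for every `ψ⁶ ≠ 1`; `claims_typeOne_of_shioda`,
  `isOfHodgeType_two_two_typeOne_of_shioda` — the same granted `Shioda1979_claim_semiDecomposable`.

## References

* [Katz2009] N. M. Katz, Another look at the Dwork family, Progr. Math. 270 (2009), §2 pp. 5–7, §3,
  Lemma 3.1.
* [Shioda1979PJA] T. Shioda, The Hodge conjecture and the Tate conjecture for Fermat varieties, Proc.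
  Japan Acad. 55A (1979), §1 (iii), §4.
* [Ran1980] Z. Ran, Cycles on Fermat hypersurfaces, Compositio Math. 42 (1980), §1 Prop. 1.7, §4 Cor. 4.7.
* [VoisinHodgeI2002] C. Voisin, Hodge Theory and Complex Algebraic Geometry I (2002), §6.3.2 Thm. 6.32,
  §11.1.2 Prop. 11.20.
* [VoisinHodgeII2003] C. Voisin, Hodge Theory and Complex Algebraic Geometry II (2003), §6.1.3.
-/

noncomputable section

open CategoryTheory Finset
open scoped BigOperators

namespace Literature.AlgebraicGeometry.HodgeTheory.DworkSextic

open Literature.AlgebraicGeometry.Motives Literature.AlgebraicTopology.SingularHomology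

/-! ### §1 The `(4,0)`-part of the non-trivial `Γ_W`-pieces of `X_ψ` vanishes -/

section TopCharacter

variable {ψ : ℂ}

/-- A non-trivial character of `Γ_W` differs from `det = ∏ aᵢ ≡ 1` somewhere. [cite: Katz2009, §3] -/
theorem exists_apply_ne_prod_of_ne_one {θ : gammaW →* ℂˣ} (hθ : θ ≠ 1) :
    ∃ a : gammaW, ((θ a : ℂˣ) : ℂ) ≠ ∏ i, (((a : Fin (4 + 2) → ℂˣ) i : ℂˣ) : ℂ) := by
  by_contra h
  push Not at h
  apply hθ
  ext a
  rw [MonoidHom.one_apply, Units.val_one, h a, prod_val_eq_one]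

/-- **Katz 2009, Lemma 3.1 (the `(4,0)`-part): the eigenspaces of non-trivial `Γ_W`-characters in
`H⁴(X_ψ(ℂ); ℂ)` have no `(4,0)`-component.** For `ψ⁶ ≠ 1`, a Hodge model `A` of `X_ψ`, a character
`θ ≠ 1` of `Γ_W`, and `x ∈ V_θ` with `A^* x ∈ H^{4,0}_A`: `x = 0`. Instance of
`hypersurface_eigenspace_hodgePQ_top_zero_eq_zero_of_ne_prod` (`F_ψ` is a nonsingular sextic in six
variables for `ψ⁶ ≠ 1`, `Γ_W ≤ diagonalStabilizer F_ψ`, `∏ aᵢ = 1` on `Γ_W`). In print: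
`H^{4,0}(X_ψ) = ℂ · Res(Ω/F_ψ)` is `Γ_W`-invariant. [cite: Katz2009, §3 and Lemma 3.1]
[cite: VoisinHodgeII2003, §6.1.3 and Cor. 6.12 (p = 1)] -/
theorem eq_zero_of_mem_eigenspace_of_hodgePQ_four_zero (hψ : ψ ^ 6 ≠ 1)
    (A : HodgeModel 4 (fibre ψ)) (θ : gammaW →* ℂˣ) (hθ : θ ≠ 1)
    {x : complexBetti (fibre ψ) (2 * 2)}
    (hx : x ∈ diagonalCharacterEigenspace (form ψ) gammaW θ (2 * 2))
    (hxA : A.pullback (2 * 2) x ∈ A.hodgePQ (2 * 2) 4 0) : x = 0 :=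
  hypersurface_eigenspace_hodgePQ_top_zero_eq_zero_of_ne_prod (n := 4) (isHomogeneous_form ψ)
    (isNonsingularForm_form hψ) (isSmoothProjective_fibre hψ) (gammaW_le_diagonalStabilizer ψ) θ
    (exists_apply_ne_prod_of_ne_one hθ) A hx hxA

/-- **The `Γ_W`-character of `H^{4,0}(X_ψ)` is trivial** (`ψ⁶ ≠ 1`), in the shape of the hypothesis
`hZ` of the route files of `hodge-nonav` (`flatClassesSpannedByReflectionInvariants_of_topCharacter`):
for every Hodge model `A`, every character `θ ≠ 1` of `Γ_W` and every `x ∈ V_θ` with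
`A^* x ∈ H^{4,0}_A`, `x = 0`. [cite: Katz2009, §3 and Lemma 3.1] -/
theorem topCharacter_trivial (hψ : ψ ^ 6 ≠ 1) :
    ∀ (A : HodgeModel 4 (fibre ψ)) (θ : gammaW →* ℂˣ), θ ≠ 1 →
      ∀ x ∈ diagonalCharacterEigenspace (form ψ) gammaW θ (2 * 2),
        A.pullback (2 * 2) x ∈ A.hodgePQ (2 * 2) 4 0 → x = 0 :=
  fun A θ hθ _ hx hxA ↦ eq_zero_of_mem_eigenspace_of_hodgePQ_four_zero hψ A θ hθ hx hxA

end TopCharacter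

/-! ### §2 Purity of a `Γ_W`-piece of `X_ψ` from purity at the Fermat point -/

section Fermat

variable {ψ : ℂ}

/-- **Purity `(2,2)` of a `Γ_W`-piece of `X_ψ` from purity at the Fermat point** (`ψ⁶ ≠ 1`, `χ ≠ 1`):
if for some Hodge model `A₀` of `X⁴₆` the `Γ_W`-eigenspaces of `χ` and `χ⁻¹` in `H⁴(X⁴₆(ℂ); ℂ)` pull
back into `H^{2,2}_{A₀}`, then `V_χ(X_ψ)` pulls back into `H^{2,2}_A` for every Hodge model `A` of
`X_ψ` — `pullback_mem_hodgePQ_two_two_of_transport` fed with the transport data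
(`exists_transportData`) and the now unconditional `(4,0)`-statement (`topCharacter_trivial`).
[cite: Katz2009, Lemma 3.1(2)] [cite: VoisinHodgeI2002, §6.3.2 Thm. 6.32] -/
theorem pullback_mem_hodgePQ_two_two_of_fermat (hψ : ψ ^ 6 ≠ 1) (A : HodgeModel 4 (fibre ψ))
    (A₀ : HodgeModel 4 (fermatHypersurface 4 6)) {χ : gammaW →* ℂˣ} (hχ : χ ≠ 1)
    (hχF : ∀ c ∈ diagonalCharacterEigenspace (fermatPolynomial ℂ 4 6) gammaW χ (2 * 2),
      A₀.pullback (2 * 2) c ∈ A₀.hodgePQ (2 * 2) 2 2)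
    (hχF' : ∀ c ∈ diagonalCharacterEigenspace (fermatPolynomial ℂ 4 6) gammaW χ⁻¹ (2 * 2),
      A₀.pullback (2 * 2) c ∈ A₀.hodgePQ (2 * 2) 2 2)
    {c : complexBetti (fibre ψ) (2 * 2)} (hc : c ∈ diagonalCharacterEigenspace (form ψ) gammaW χ (2 * 2)) :
    A.pullback (2 * 2) c ∈ A.hodgePQ (2 * 2) 2 2 := by
  obtain ⟨T, T', hTinj, hTeq, hTconj, hT', hTamb⟩ := exists_transportData hψ
  exact pullback_mem_hodgePQ_two_two_of_transport hψ A A₀ hχ hχF hχF' (topCharacter_trivial hψ A) T hTinj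
    hTeq hTconj T' hT' hTamb hc

/-- **Katz's remaining flat type `j = 1` at `ψ⁶ ≠ 1` from the Fermat point**: if for some Hodge model
`A₀` of `X⁴₆` the `Γ_W`-eigenspaces of `χ_{e₁∘σ}` and `χ_{(6−e₁)∘σ}`, `e₁ = (1,2,2,3,5,5)`, in
`H⁴(X⁴₆(ℂ); ℂ)` are of type `(2,2)`, then so are the corresponding eigenspaces of `X_ψ` (the two
characters are mutually inverse, `character_flatTypes_inv`). [cite: Katz2009, Lemma 3.1(2)]
[cite: VoisinHodgeI2002, §6.3.2 Thm. 6.32] -/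
theorem typeOne_pullback_mem_hodgePQ_two_two_of_fermat (hψ : ψ ^ 6 ≠ 1) (σ : Equiv.Perm (Fin 6))
    (A : HodgeModel 4 (fibre ψ)) (A₀ : HodgeModel 4 (fermatHypersurface 4 6))
    (hF : ∀ c ∈ diagonalCharacterEigenspace (fermatPolynomial ℂ 4 6) gammaW
        (character fun l => flatTypes 1 (σ l)) (2 * 2), A₀.pullback (2 * 2) c ∈ A₀.hodgePQ (2 * 2) 2 2)
    (hF' : ∀ c ∈ diagonalCharacterEigenspace (fermatPolynomial ℂ 4 6) gammaW
        (character fun l => 6 - flatTypes 1 (σ l)) (2 * 2), A₀.pullback (2 * 2) c ∈ A₀.hodgePQ (2 * 2) 2 2) :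
    (∀ c ∈ diagonalCharacterEigenspace (form ψ) gammaW (character fun l => flatTypes 1 (σ l)) (2 * 2),
        A.pullback (2 * 2) c ∈ A.hodgePQ (2 * 2) 2 2) ∧
    (∀ c ∈ diagonalCharacterEigenspace (form ψ) gammaW (character fun l => 6 - flatTypes 1 (σ l)) (2 * 2),
        A.pullback (2 * 2) c ∈ A.hodgePQ (2 * 2) 2 2) := by
  obtain ⟨hne, hne', hinv, hinv'⟩ := character_flatTypes_inv 1 σ
  exact ⟨fun c hc => pullback_mem_hodgePQ_two_two_of_fermat hψ A A₀ hne hF (hinv ▸ hF') hc,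
    fun c hc => pullback_mem_hodgePQ_two_two_of_fermat hψ A A₀ hne' hF' (hinv' ▸ hF) hc⟩

/-- `IsEig` / `IsOfHodgeType` form of `typeOne_pullback_mem_hodgePQ_two_two_of_fermat`: granted the
Fermat-point purity of the type-`1` pieces (for every Hodge model of `X⁴₆`), eigenclasses of `X_ψ`
(`ψ⁶ ≠ 1`) of the types `(1,2,2,3,5,5) ∘ σ` and `(6 − ·) ∘ σ` are `IsOfHodgeType 4 X_ψ 4 2 2` — the
hypothesis `hJ1` of `flatClassesSpannedByReflectionInvariants_of_topCharacter_of_typeOne`.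
[cite: Katz2009, Lemma 3.1(2)] -/
theorem isOfHodgeType_two_two_typeOne_of_fermat (hψ : ψ ^ 6 ≠ 1) (σ : Equiv.Perm (Fin 6))
    (hF1 : ∀ A₀ : HodgeModel 4 (fermatHypersurface 4 6),
      (∀ c ∈ diagonalCharacterEigenspace (fermatPolynomial ℂ 4 6) gammaW
        (character fun l => flatTypes 1 (σ l)) (2 * 2), A₀.pullback (2 * 2) c ∈ A₀.hodgePQ (2 * 2) 2 2) ∧
      (∀ c ∈ diagonalCharacterEigenspace (fermatPolynomial ℂ 4 6) gammaW
        (character fun l => 6 - flatTypes 1 (σ l)) (2 * 2), A₀.pullback (2 * 2) c ∈ A₀.hodgePQ (2 * 2) 2 2))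
    {u v : complexBetti (fibre ψ) (2 * 2)}
    (hu : IsEig ψ (fun l => flatTypes 1 (σ l)) u) (hv : IsEig ψ (fun l => 6 - flatTypes 1 (σ l)) v) :
    IsOfHodgeType 4 (fibre ψ) (2 * 2) 2 2 u ∧ IsOfHodgeType 4 (fibre ψ) (2 * 2) 2 2 v := by
  obtain ⟨A⟩ := nonempty_hodgeModel_holds (n := 4) (X := fibre ψ) (isSmoothProjective_fibre hψ)
  obtain ⟨A₀⟩ := nonempty_hodgeModel_holds (n := 4) (X := fermatHypersurface 4 6)
    (isSmoothProjective_fermatHypersurface (by norm_num) (by norm_num))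
  obtain ⟨hF, hF'⟩ := hF1 A₀
  obtain ⟨h1, h2⟩ := typeOne_pullback_mem_hodgePQ_two_two_of_fermat hψ σ A A₀ hF hF'
  exact ⟨⟨A, h1 _ (mem_eigenspace_of_isEig hu)⟩, ⟨A, h2 _ (mem_eigenspace_of_isEig hv)⟩⟩

end Fermat

/-! ### §3 The Fermat point: pieces with claimed translates; the type `j = 1` from Shioda's theorem -/

section Shioda

/-- **A `Γ_W`-piece of `H⁴(X⁴₆(ℂ); ℂ)` all of whose totally nonzero translates are spanned by algebraic
cycles is of type `(2,2)`.** Let `e : Fin 6 → ℕ` be not constant mod `6`, and suppose `claim(e + r·𝟙)`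
(`FermatCharacter.Claim 6 2`: the torus line `V(e + r·𝟙)` lies in the span of the classes of
codimension-`2` cycles) for every `r` with `e + r·𝟙` totally nonzero. Then the `Γ_W`-eigenspace of
`χ_e` pulls back into `H^{2,2}_A` for every Hodge model `A` of `X⁴₆`: it lies in `⊕_r V(e + r·𝟙)`
(`fermat_gammaW_eigenspace_le`, `exists_translate_of_character_eq`), the translates with a zero
coordinate contribute `0` (`fermatEigenspace_eq_bot_of_apply_eq_zero`), and algebraic classes are of
type `(2,2)` (`isOfHodgeType_of_mem_algebraicClasses_of_isSmoothProjective`, Voisin I Prop. 11.20).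
[cite: Katz2009, Lemma 3.1 (proof, p. 8)] [cite: VoisinHodgeI2002, §11.1.2 Prop. 11.20]
[cite: Shioda1979PJA, §4] -/
theorem fermat_gammaW_eigenspace_pullback_mem_hodgePQ_two_two_of_claim
    (A : HodgeModel 4 (fermatHypersurface 4 6)) {e : Fin 6 → ℕ}
    (hnc : ∃ i j, (e i : ZMod 6) ≠ (e j : ZMod 6))
    (hcl : ∀ r : ZMod 6, IsTotallyNonzero (translate e r) → FermatCharacter.Claim 6 2 (translate e r))
    {c : complexBetti (fermatHypersurface 4 6) (2 * 2)}
    (hc : c ∈ diagonalCharacterEigenspace (fermatPolynomial ℂ 4 6) gammaW (character e) (2 * 2)) :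
    A.pullback (2 * 2) c ∈ A.hodgePQ (2 * 2) 2 2 := by
  classical
  have hX : IsSmoothProjective 4 (fermatHypersurface 4 6) :=
    isSmoothProjective_fermatHypersurface (by norm_num) (by norm_num)
  have hle := fermat_gammaW_eigenspace_le (character e)
  suffices h : (⨆ (α : Fin (4 + 2) → ZMod 6)
      (_ : (fermatCharacter 6 α).comp (Subgroup.inclusion gammaW_le_fermatGroup) = character e),
      fermatEigenspace 6 α (2 * 2)) ≤ (A.hodgePQ (2 * 2) 2 2).comap (A.pullback (2 * 2)).hom from
    h (hle hc)
  refine iSup₂_le fun α hα x hx => ?_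
  rw [Submodule.mem_comap]
  change A.pullback (2 * 2) x ∈ A.hodgePQ (2 * 2) 2 2
  rw [fermatCharacter_comp_inclusion] at hα
  obtain ⟨r, hr⟩ := exists_translate_of_character_eq hα
  simp only [ZMod.natCast_val, ZMod.cast_id', id_eq] at hr
  -- `α = e + r·𝟙 (mod 6) = translate e r`
  have hαt : α = translate e r := funext fun i => by rw [hr i]; rfl
  have hα0 : α ≠ 0 := by
    obtain ⟨i, j, hij⟩ := hnc
    intro h0
    have hi := hr i
    have hj := hr j
    rw [h0, Pi.zero_apply] at hi hj
    exact hij (add_right_cancel (hi.symm.trans hj))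
  by_cases htot : IsTotallyNonzero (translate e r)
  · -- a claimed line: algebraic classes are of type `(2,2)`
    have halg : x ∈ algebraicClasses (fermatHypersurface (2 * 2) 6) 2 := hcl r htot (hαt ▸ hx)
    exact (isOfHodgeType_iff_mem_hodgePQ hX A x).1
      (isOfHodgeType_of_mem_algebraicClasses_of_isSmoothProjective hX 2 halg)
  · obtain ⟨i, hi⟩ : ∃ i, translate e r i = 0 := by
      by_contra h
      exact htot fun i h0 => h ⟨i, h0⟩
    rw [← hαt] at hi
    rw [fermatEigenspace_eq_bot_of_apply_eq_zero (m := 6) (by norm_num) (r := 2) (by norm_num) hα0 hi] at hx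
    rw [(Submodule.mem_bot ℂ).mp hx, map_zero]
    exact Submodule.zero_mem _

/-- **The totally nonzero translates of the type `(1,2,2,3,5,5)` and of its conjugate, from four
explicit claims.** `(1,2,2,3,5,5) + r·𝟙` is totally nonzero only for `r = 0, 2` (translates
`(1,2,2,3,5,5)`, `(3,4,4,5,1,1)`), and `(5,4,4,3,1,1) + r·𝟙` only for `r = 0, 4` (translates
`(5,4,4,3,1,1)`, `(3,2,2,1,5,5)`); so claim of these four torus lines of `X⁴₆` — "`V(α)` is spanned by
the classes of algebraic `2`-cycles" — gives claim of every totally nonzero translate. (Two of the four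
suffice: the last two are the negatives of the first two, `FermatCharacter.Claim.neg`.)
[cite: Katz2009, Lemma 3.1 (proof, p. 8)] [cite: Shioda1979PJA, §4] -/
theorem claim_translate_flatTypes_one_of_claims
    (h₁ : FermatCharacter.Claim 6 2 ![1, 2, 2, 3, 5, 5]) (h₂ : FermatCharacter.Claim 6 2 ![3, 4, 4, 5, 1, 1])
    (h₃ : FermatCharacter.Claim 6 2 ![5, 4, 4, 3, 1, 1]) (h₄ : FermatCharacter.Claim 6 2 ![3, 2, 2, 1, 5, 5]) :
    (∀ r : ZMod 6, IsTotallyNonzero (translate (flatTypes 1) r) →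
      FermatCharacter.Claim 6 2 (translate (flatTypes 1) r)) ∧
    (∀ r : ZMod 6, IsTotallyNonzero (translate (fun l => 6 - flatTypes 1 l) r) →
      FermatCharacter.Claim 6 2 (translate (fun l => 6 - flatTypes 1 l) r)) := by
  refine ⟨fun r hr => ?_, fun r hr => ?_⟩
  · have hr' : r = 0 ∨ r = 2 := by
      revert hr; revert r; decide
    rcases hr' with rfl | rfl
    · exact FermatCharacter.Claim.of_univ_val_map_eq (by decide) h₁
    · exact FermatCharacter.Claim.of_univ_val_map_eq (by decide) h₂
  · have hr' : r = 0 ∨ r = 4 := by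
      revert hr; revert r; decide
    rcases hr' with rfl | rfl
    · exact FermatCharacter.Claim.of_univ_val_map_eq (by decide) h₃
    · exact FermatCharacter.Claim.of_univ_val_map_eq (by decide) h₄

/-- **Shioda's theorem on semi-decomposable characters claims the four type-`1` lines**:
`(1,2,2,3,5,5) = {1,2,3} ⊔ {2,5,5}`, `(3,4,4,5,1,1) = {3,4,5} ⊔ {4,1,1}`, `(5,4,4,3,1,1) = {5,4,3} ⊔ {4,1,1}`,
`(3,2,2,1,5,5) = {3,2,1} ⊔ {2,5,5}` — two zero-free zero-sum triples each, and Hodge characters (all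
`decide`), so the named fact `Shioda1979_claim_semiDecomposable` (Shioda 1979 PJA §1 (iii), §4; Ran
1980 §4 Cor. 4.7) applies. CONDITIONAL on the named fact. [cite: Shioda1979PJA, §1 Definition (iii) and §4]
[cite: Ran1980, §4 Cor. 4.7] -/
theorem claims_typeOne_of_shioda (hS : Shioda1979_claim_semiDecomposable) :
    FermatCharacter.Claim 6 2 ![1, 2, 2, 3, 5, 5] ∧ FermatCharacter.Claim 6 2 ![3, 4, 4, 5, 1, 1] ∧
    FermatCharacter.Claim 6 2 ![5, 4, 4, 3, 1, 1] ∧ FermatCharacter.Claim 6 2 ![3, 2, 2, 1, 5, 5] := by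
  refine ⟨?_, ?_, ?_, ?_⟩
  · exact hS 6 ![1, 2, 3] ![2, 5, 5] _ (by decide) (by decide) (by decide) (by decide)
      (by unfold FermatCharacter.IsHodge FermatCharacter.IsAdmissible FermatCharacter.normSum; decide)
      (by decide)
  · exact hS 6 ![3, 4, 5] ![4, 1, 1] _ (by decide) (by decide) (by decide) (by decide)
      (by unfold FermatCharacter.IsHodge FermatCharacter.IsAdmissible FermatCharacter.normSum; decide)
      (by decide)
  · exact hS 6 ![5, 4, 3] ![4, 1, 1] _ (by decide) (by decide) (by decide) (by decide)
      (by unfold FermatCharacter.IsHodge FermatCharacter.IsAdmissible FermatCharacter.normSum; decide)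
      (by decide)
  · exact hS 6 ![3, 2, 1] ![2, 5, 5] _ (by decide) (by decide) (by decide) (by decide)
      (by unfold FermatCharacter.IsHodge FermatCharacter.IsAdmissible FermatCharacter.normSum; decide)
      (by decide)

/-- Claimed translates are stable under permutations of the coordinates: if every totally nonzero
translate of `e` is claimed, so is every totally nonzero translate of `e ∘ σ`
(`translate (e ∘ σ) r = (translate e r) ∘ σ`, `FermatCharacter.Claim.comp_perm`).
[cite: Shioda1979PJA, §4] -/
theorem claim_translate_comp_perm {e : Fin 6 → ℕ}
    (hcl : ∀ r : ZMod 6, IsTotallyNonzero (translate e r) → FermatCharacter.Claim 6 2 (translate e r))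
    (σ : Equiv.Perm (Fin 6)) :
    ∀ r : ZMod 6, IsTotallyNonzero (translate (fun l => e (σ l)) r) →
      FermatCharacter.Claim 6 2 (translate (fun l => e (σ l)) r) := by
  intro r htot
  rw [translate_comp_perm] at htot ⊢
  have htot' : IsTotallyNonzero (translate e r) := fun i => by
    simpa using htot (σ.symm i)
  exact (hcl r htot').comp_perm σ

/-- **If the four type-`1` torus lines of `X⁴₆` are spanned by algebraic cycles, the type-`1`
`Γ_W`-pieces of `X⁴₆` are pure `(2,2)`**: for every `σ ∈ 𝔖₆` and every Hodge model `A₀` of `X⁴₆`, the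
`Γ_W`-eigenspaces of `χ_{(1,2,2,3,5,5)∘σ}` and `χ_{(5,4,4,3,1,1)∘σ}` in `H⁴(X⁴₆(ℂ); ℂ)` pull back into
`H^{2,2}_{A₀}` (`fermat_gammaW_eigenspace_pullback_mem_hodgePQ_two_two_of_claim` with
`claim_translate_flatTypes_one_of_claims`). [cite: Katz2009, Lemma 3.1] [cite: Shioda1979PJA, §4]
[cite: VoisinHodgeI2002, §11.1.2 Prop. 11.20] -/
theorem fermat_typeOne_pullback_mem_hodgePQ_two_two_of_claims
    (h₁ : FermatCharacter.Claim 6 2 ![1, 2, 2, 3, 5, 5]) (h₂ : FermatCharacter.Claim 6 2 ![3, 4, 4, 5, 1, 1])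
    (h₃ : FermatCharacter.Claim 6 2 ![5, 4, 4, 3, 1, 1]) (h₄ : FermatCharacter.Claim 6 2 ![3, 2, 2, 1, 5, 5])
    (σ : Equiv.Perm (Fin 6)) (A₀ : HodgeModel 4 (fermatHypersurface 4 6)) :
    (∀ c ∈ diagonalCharacterEigenspace (fermatPolynomial ℂ 4 6) gammaW
        (character fun l => flatTypes 1 (σ l)) (2 * 2), A₀.pullback (2 * 2) c ∈ A₀.hodgePQ (2 * 2) 2 2) ∧
    (∀ c ∈ diagonalCharacterEigenspace (fermatPolynomial ℂ 4 6) gammaW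
        (character fun l => 6 - flatTypes 1 (σ l)) (2 * 2), A₀.pullback (2 * 2) c ∈ A₀.hodgePQ (2 * 2) 2 2) := by
  obtain ⟨hc1, hc2⟩ := claim_translate_flatTypes_one_of_claims h₁ h₂ h₃ h₄
  obtain ⟨hn1, hn2⟩ := flatTypes_comp_perm_not_const 1 σ
  exact ⟨fun c hc => fermat_gammaW_eigenspace_pullback_mem_hodgePQ_two_two_of_claim A₀ hn1
      (claim_translate_comp_perm hc1 σ) hc,
    fun c hc => fermat_gammaW_eigenspace_pullback_mem_hodgePQ_two_two_of_claim A₀ hn2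
      (claim_translate_comp_perm (e := fun l => 6 - flatTypes 1 l) hc2 σ) hc⟩

/-- **If the four type-`1` torus lines of `X⁴₆` are spanned by algebraic cycles, the type-`1`
eigenclasses of `X_ψ` (`ψ⁶ ≠ 1`) are of Hodge type `(2,2)`** — the hypothesis `hJ1` of the route files,
from the Fermat point (`fermat_typeOne_pullback_mem_hodgePQ_two_two_of_claims`) along the transport
(`isOfHodgeType_two_two_typeOne_of_fermat`). CONDITIONAL on the four displayed claims only (no named
fact). [cite: Katz2009, Lemma 3.1(2)] [cite: Shioda1979PJA, §4] -/
theorem isOfHodgeType_two_two_typeOne_of_claims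
    (h₁ : FermatCharacter.Claim 6 2 ![1, 2, 2, 3, 5, 5]) (h₂ : FermatCharacter.Claim 6 2 ![3, 4, 4, 5, 1, 1])
    (h₃ : FermatCharacter.Claim 6 2 ![5, 4, 4, 3, 1, 1]) (h₄ : FermatCharacter.Claim 6 2 ![3, 2, 2, 1, 5, 5])
    {ψ : ℂ} (hψ : ψ ^ 6 ≠ 1) (σ : Equiv.Perm (Fin 6)) {u v : complexBetti (fibre ψ) (2 * 2)}
    (hu : IsEig ψ (fun l => flatTypes 1 (σ l)) u) (hv : IsEig ψ (fun l => 6 - flatTypes 1 (σ l)) v) :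
    IsOfHodgeType 4 (fibre ψ) (2 * 2) 2 2 u ∧ IsOfHodgeType 4 (fibre ψ) (2 * 2) 2 2 v :=
  isOfHodgeType_two_two_typeOne_of_fermat hψ σ
    (fun A₀ => fermat_typeOne_pullback_mem_hodgePQ_two_two_of_claims h₁ h₂ h₃ h₄ σ A₀) hu hv

/-- **Granted `Shioda1979_claim_semiDecomposable`, the type-`1` eigenclasses of `X_ψ` (`ψ⁶ ≠ 1`) are of
Hodge type `(2,2)`** (`claims_typeOne_of_shioda` and `isOfHodgeType_two_two_typeOne_of_claims`).
CONDITIONAL on the named fact (Shioda 1979 PJA §4 / Ran 1980 §4: semi-decomposable Hodge characters of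
`X⁴ₘ` are cycle characters). [cite: Shioda1979PJA, §4] [cite: Katz2009, Lemma 3.1(2)] -/
theorem isOfHodgeType_two_two_typeOne_of_shioda (hS : Shioda1979_claim_semiDecomposable) {ψ : ℂ}
    (hψ : ψ ^ 6 ≠ 1) (σ : Equiv.Perm (Fin 6)) {u v : complexBetti (fibre ψ) (2 * 2)}
    (hu : IsEig ψ (fun l => flatTypes 1 (σ l)) u) (hv : IsEig ψ (fun l => 6 - flatTypes 1 (σ l)) v) :
    IsOfHodgeType 4 (fibre ψ) (2 * 2) 2 2 u ∧ IsOfHodgeType 4 (fibre ψ) (2 * 2) 2 2 v := by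
  obtain ⟨h₁, h₂, h₃, h₄⟩ := claims_typeOne_of_shioda hS
  exact isOfHodgeType_two_two_typeOne_of_claims h₁ h₂ h₃ h₄ hψ σ hu hv

end Shioda

end Literature.AlgebraicGeometry.HodgeTheory.DworkSextic

end
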